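import Mathlib

/-!
# SoloInformed — one zone, and volume pile-up (kernel shadows of NEARZONE LEMMAS N1 (vi) and N2 (e))

Soloist `solo-FinalStateConjecture-informed`, session 28 (2026-08-19). Pure topology / measure theory,
no geometry imported: the two elementary facts on which `paper/NEARZONE.md` rests its replacement of the
near-zone rigidity hypothesis (NZR) by a counting argument. Dictionary. `U i` = the late-region images
("tubes") of the Kerr-family charts truncated at ONE fixed radius — OPEN (charts are open embeddings) and
PAIRWISE DISJOINT (the typed field `exists_pairwise_disjoint` of `FinalStateDecomposition`); `s` = the late
near-hole shell `𝒩_{R₀}` of a settled hole (connected, meets chart 1's tube). `K n` = the boxes produced by a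
second chart near the same hole: pairwise disjoint, measurable, each of intrinsic 4-volume `≥ v > 0`, all
inside `C ∪ T` where `C` is a compact slab of the near zone (finite volume) and `T` is chart 1's tube, which
they avoid (disjointness at the fixed radius).

* `subset_of_isPreconnected_of_pairwise_disjoint` — a preconnected set covered by pairwise disjoint open
  sets and meeting one of them lies inside that one (LEMMA N1 (vi): the shell carries ONE chart index);
* `measure_iUnion_eq_top_of_le` — countably many pairwise disjoint measurable sets of measure `≥ v > 0`
  have a union of infinite measure;
* `measure_eq_top_of_disjoint_boxes`, `not_disjoint_boxes_in_finite_slab` — such boxes cannot all lie in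
  `C ∪ T` while avoiding `T` when `μ C < ∞` (LEMMA N2 (e): ONE KERR CHART PER HOLE).

[folklore]
-/

noncomputable section

open Set MeasureTheory Function
open scoped ENNReal

namespace Summit.FinalStateConjecture.FinalStateConjecture.Theorems

/-- **One index.** A preconnected set `s` covered by a family of pairwise disjoint open sets `U i`
and meeting `U i₀` is contained in `U i₀`. (NEARZONE LEMMA N1 (vi): the connected late near-hole
shell lies in ONE chart's tube.) [folklore] -/
theorem subset_of_isPreconnected_of_pairwise_disjoint {α ι : Type*} [TopologicalSpace α]
    {s : Set α} (hs : IsPreconnected s) {U : ι → Set α} (hU : ∀ i, IsOpen (U i))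
    (hdisj : Pairwise (Disjoint on U)) (hcover : s ⊆ ⋃ i, U i) {i₀ : ι}
    (hmeet : (s ∩ U i₀).Nonempty) : s ⊆ U i₀ := by
  set v : Set α := ⋃ (i : ι) (_ : i ≠ i₀), U i with hv
  have hvo : IsOpen v := isOpen_iUnion fun i => isOpen_iUnion fun _ => hU i
  have huv : Disjoint (U i₀) v := by
    rw [hv, Set.disjoint_iUnion_right]
    intro i
    rw [Set.disjoint_iUnion_right]
    intro hi
    exact hdisj hi.symm
  have hsuv : s ⊆ U i₀ ∪ v := by
    intro x hx
    obtain ⟨i, hi⟩ := Set.mem_iUnion.1 (hcover hx)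
    by_cases h : i = i₀
    · exact Or.inl (h ▸ hi)
    · exact Or.inr (Set.mem_iUnion₂.2 ⟨i, h, hi⟩)
  exact hs.subset_left_of_subset_union (hU i₀) hvo huv hsuv hmeet

/-- **The index is unique.** Under the same hypotheses, if `s` is nonempty and meets both `U i₀` and
`U i₁` then `i₀ = i₁`. [folklore] -/
theorem index_unique_of_isPreconnected {α ι : Type*} [TopologicalSpace α]
    {s : Set α} (hs : IsPreconnected s) {U : ι → Set α} (hU : ∀ i, IsOpen (U i))
    (hdisj : Pairwise (Disjoint on U)) (hcover : s ⊆ ⋃ i, U i) {i₀ i₁ : ι}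
    (h₀ : (s ∩ U i₀).Nonempty) (h₁ : (s ∩ U i₁).Nonempty) : i₀ = i₁ := by
  by_contra hne
  obtain ⟨x, hxs, hx₁⟩ := h₁
  have hx₀ : x ∈ U i₀ := subset_of_isPreconnected_of_pairwise_disjoint hs hU hdisj hcover h₀ hxs
  exact Set.disjoint_left.1 (hdisj hne) hx₀ hx₁

/-- **Volume pile-up.** Countably many pairwise disjoint measurable sets, each of measure at least
`v ≠ 0`, have a union of infinite measure. [folklore] -/
theorem measure_iUnion_eq_top_of_le {α : Type*} [MeasurableSpace α] (μ : Measure α)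
    {K : ℕ → Set α} (hmeas : ∀ n, MeasurableSet (K n)) (hdisj : Pairwise (Disjoint on K))
    {v : ℝ≥0∞} (hv : v ≠ 0) (hle : ∀ n, v ≤ μ (K n)) : μ (⋃ n, K n) = ∞ := by
  rw [measure_iUnion hdisj hmeas]
  apply top_unique
  calc (⊤ : ℝ≥0∞) = ∑' _ : ℕ, v := (ENNReal.tsum_const_eq_top_of_ne_zero hv).symm
    _ ≤ ∑' n, μ (K n) := ENNReal.tsum_le_tsum hle

/-- **Boxes avoiding the tube fill the slab.** If such boxes all lie in `C ∪ T` and avoid `T`, then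
`μ C = ∞`. (NEARZONE LEMMA N2 (d)–(e): the second chart's boxes avoid chart 1's tube `T` by the typed
disjointness, so they pile up in the compact slab `C`.) [folklore] -/
theorem measure_eq_top_of_disjoint_boxes {α : Type*} [MeasurableSpace α] (μ : Measure α)
    {K : ℕ → Set α} (hmeas : ∀ n, MeasurableSet (K n)) (hdisj : Pairwise (Disjoint on K))
    {v : ℝ≥0∞} (hv : v ≠ 0) (hle : ∀ n, v ≤ μ (K n))
    {C T : Set α} (hsub : ∀ n, K n ⊆ C ∪ T) (hT : ∀ n, Disjoint (K n) T) : μ C = ∞ := by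
  have hKC : (⋃ n, K n) ⊆ C := by
    intro x hx
    obtain ⟨n, hn⟩ := Set.mem_iUnion.1 hx
    rcases hsub n hn with h | h
    · exact h
    · exact absurd h (Set.disjoint_left.1 (hT n) hn)
  have hmono : μ (⋃ n, K n) ≤ μ C := measure_mono hKC
  rw [measure_iUnion_eq_top_of_le μ hmeas hdisj hv hle] at hmono
  exact top_le_iff.1 hmono

/-- **One Kerr chart per hole (counting form).** With `μ C < ∞` the configuration of
`measure_eq_top_of_disjoint_boxes` is impossible. [folklore] -/
theorem not_disjoint_boxes_in_finite_slab {α : Type*} [MeasurableSpace α] (μ : Measure α)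
    {K : ℕ → Set α} (hmeas : ∀ n, MeasurableSet (K n)) (hdisj : Pairwise (Disjoint on K))
    {v : ℝ≥0∞} (hv : v ≠ 0) (hle : ∀ n, v ≤ μ (K n))
    {C T : Set α} (hC : μ C ≠ ∞) (hsub : ∀ n, K n ⊆ C ∪ T) (hT : ∀ n, Disjoint (K n) T) : False :=
  hC (measure_eq_top_of_disjoint_boxes μ hmeas hdisj hv hle hsub hT)

end Summit.FinalStateConjecture.FinalStateConjecture.Theorems

end
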